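import Summits.Ventures.HSemireg.Mod4TwoSlopeSpectrumGeneral

/-!
# Venture HSemireg — MOD-4 line: the POINT-CLASS h-part `f = B·pt` (`q_m = B·[m = 2n]`): `M_f(q) = 0`, `rank H_k(q) = 1`,
# `P_f(q) = 0` (TABLE R's «one slope at ∞» row for EVERY `n`: the same rank data as the one-slope row `A e^{λh}`)

HONEST FRAMING. Part of the Lean index of the computation cell `pub-hsemireg` (seat w3-mod4-1 gen 13, W3 SPECIAL FIBRES; file of
record `HOME/widen/W3/MOD4-OFFSPLIT-w3mod4.md`, §13.19 NET «not covered: the one-slope-at-∞ shape `f = s·pt` alone»). ELEMENTARY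
LINEAR ALGEBRA over a field ONLY: no abelian variety, no sheaf, no Ext group, no semiregularity map; nothing here says that
HC / HC_CM / HC_AV holds; no Literature fact is declared; NO definition is introduced.

WHAT IS PROVED, for the sequence `q_m = B·[m = N]` supported at the top index alone (the `λ → ∞` end of the one-slope family;
`N = 2n` on a `2n`-fold):
* **`middleM_point_eq_zero`** / `middleM_point_mulVec` — `M_f(q) = 0` for `n ≥ 1` (no product `q_{n-a+m} q_{n-m+b}` has both
  indices equal to `2n` when `a, b, m ≤ n`, `n ≥ 1`);
* **`finrank_ker_middleM_point`** — `t ≠ 0` ⇒ `dim ker(M_f(q) − t) = 0` (no box locus);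
* **`hankel1_rank_point`** — `B ≠ 0`, `k ≤ N`: `rank H_k(q) = 1` (`H_k(q)` has the single non-zero entry `(k, N − k)`; its range is
  the line of the last basis vector);
* **`mukaiP_point`** — `Σ_{j ≤ 2n} (-1)^j C(2n,j) q_j q_{2n-j} = 0` (`n ≥ 1`): `(f,f)_χ = 0`, the point class pairs to zero with itself.
So the row `v = B·pt + w` of TABLE R carries exactly the rank data of the one-slope row (`Mod4OneSlopeSpectrum`: `r_k = 1`,
`M_f = 0`, `P_f = 0`), as the degree-reversal symmetry `m ↦ 2n − m` of the table predicts. Everything PROVED, 0 sorry.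
Namespace `Summit.Ventures.HSemireg.Mod4`.
References: [BourbakiAlgebre1a3] Ch. III §8; [BuchweitzFlenner2008HH] Prop. 6.4.4 (why this matrix).
-/

namespace Summit.Ventures.HSemireg.Mod4

open Finset Matrix

variable {K : Type*} [Field K]

/-- **`M_f(q) = 0`** for the point sequence `q_m = B·[m = 2n]`, `n ≥ 1`: every product `q_{n-a+m} · q_{n-m+b}` in an entry of
`M_f` has at least one index `< 2n`. [cite: BourbakiAlgebre1a3, Ch. III §8] -/
theorem middleM_point_eq_zero {n : ℕ} (hn : 1 ≤ n) (B : K) :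
    middleM n (fun m => if m = n + n then B else 0) = 0 := by
  ext a b
  have ha := a.isLt
  have hb := b.isLt
  simp only [middleM, Matrix.zero_apply]
  refine mul_eq_zero_of_right _ (Finset.sum_eq_zero fun m _ => ?_)
  have hm := m.isLt
  split_ifs with h1 h2
  · exfalso; omega
  · rw [mul_zero]
  · rw [mul_zero, zero_mul]
  · rw [mul_zero]

/-- **`M_f(q) v = 0` on every vector** for the point sequence (`n ≥ 1`). [cite: BourbakiAlgebre1a3, Ch. III §8] -/
theorem middleM_point_mulVec {n : ℕ} (hn : 1 ≤ n) (B : K) (v : Fin (n + 1) → K) :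
    (middleM n (fun m => if m = n + n then B else 0)) *ᵥ v = 0 := by
  rw [middleM_point_eq_zero hn, Matrix.zero_mulVec]

/-- **the point row has no box locus:** `t ≠ 0` ⇒ `dim ker(M_f(q) − t) = 0` for `q_m = B·[m = 2n]` (`n ≥ 1`).
[cite: BourbakiAlgebre1a3, Ch. III §8] -/
theorem finrank_ker_middleM_point {n : ℕ} (hn : 1 ≤ n) (B : K) {t : K} (ht0 : t ≠ 0) :
    Module.finrank K ↥(LinearMap.ker
      (Matrix.toLin' (middleM n (fun m => if m = n + n then B else 0)) - t • LinearMap.id)) = 0 := by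
  rw [Submodule.finrank_eq_zero, LinearMap.ker_eq_bot']
  intro v hv
  rw [LinearMap.sub_apply, Matrix.toLin'_apply, LinearMap.smul_apply, LinearMap.id_apply, middleM_point_mulVec hn,
    zero_sub, neg_eq_zero] at hv
  exact (smul_eq_zero.mp hv).resolve_left ht0

/-- **`rank H_k(q) = 1`** for `q_m = B·[m = N]`, `B ≠ 0`, `k ≤ N`: `H_k(q)_{i,s} = B·[i + s = N]` vanishes except at
`(i, s) = (k, N − k)`, so the range of `H_k(q)` is the line of the last basis vector, reached by the last column.
[cite: BourbakiAlgebre1a3, Ch. III §8] -/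
theorem hankel1_rank_point {N k : ℕ} (hkN : k ≤ N) {B : K} (hB : B ≠ 0) :
    (Wedge.Hankel.hankel1 K N k (fun m => if m = N then B else 0)).rank = 1 := by
  classical
  set H := Wedge.Hankel.hankel1 K N k (fun m => if m = N then B else 0) with hH
  set gl : Fin (k + 1) → K := fun i => if (i : ℕ) = k then 1 else 0 with hgl
  have hmul : ∀ v : Fin (N + 1 - k) → K, H *ᵥ v = (B * v ⟨N - k, by omega⟩) • gl := by
    intro v
    ext i
    have hi := i.isLt
    simp only [hH, Wedge.Hankel.hankel1, mulVec, dotProduct, Matrix.of_apply, hgl, Pi.smul_apply, smul_eq_mul]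
    by_cases hik : (i : ℕ) = k
    · rw [if_pos hik, mul_one, Finset.sum_eq_single (⟨N - k, by omega⟩ : Fin (N + 1 - k))]
      · rw [if_pos (by simp only; omega)]
      · intro s _ hs
        have hs' : (s : ℕ) ≠ N - k := fun h => hs (Fin.ext h)
        have hsl := s.isLt
        rw [if_neg (by omega), zero_mul]
      · intro h
        exact absurd (Finset.mem_univ _) h
    · rw [if_neg hik, mul_zero]
      refine Finset.sum_eq_zero fun s _ => ?_
      have hsl := s.isLt
      rw [if_neg (by omega), zero_mul]
  have hgl0 : gl ≠ 0 := by
    intro h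
    have h0 := congr_fun h ⟨k, by omega⟩
    simp only [hgl, Pi.zero_apply, if_true] at h0
    exact one_ne_zero h0
  have hrange : LinearMap.range H.mulVecLin = K ∙ gl := by
    apply le_antisymm
    · rintro _ ⟨v, rfl⟩
      rw [Matrix.mulVecLin_apply, hmul]
      exact Submodule.smul_mem _ _ (Submodule.mem_span_singleton_self gl)
    · rw [Submodule.span_singleton_le_iff_mem]
      have hcol : H *ᵥ Pi.single (⟨N - k, by omega⟩ : Fin (N + 1 - k)) 1 = B • gl := by
        rw [hmul, Pi.single_eq_same, mul_one]
      have hmem : H *ᵥ Pi.single (⟨N - k, by omega⟩ : Fin (N + 1 - k)) 1 ∈ LinearMap.range H.mulVecLin := ⟨_, rfl⟩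
      rw [hcol] at hmem
      rw [show gl = B⁻¹ • (B • gl) by rw [smul_smul, inv_mul_cancel₀ hB, one_smul]]
      exact Submodule.smul_mem _ _ hmem
  change Module.finrank K ↥(LinearMap.range H.mulVecLin) = 1
  rw [hrange, finrank_span_singleton hgl0]

/-- **`P_f(q) = 0`** for `q_m = B·[m = 2n]`, `n ≥ 1`: in `Σ_{j ≤ 2n} (-1)^j C(2n,j) q_j q_{2n-j}` no term has both `j = 2n` and
`2n − j = 2n` — the Mukai self-pairing of the point class vanishes. [cite: BourbakiAlgebre1a3, Ch. III §8] -/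
theorem mukaiP_point {n : ℕ} (hn : 1 ≤ n) (B : K) :
    ∑ j ∈ Finset.range (n + n + 1), (-1 : K) ^ j * (((n + n).choose j : ℕ) : K) *
        ((if j = n + n then B else 0) * (if n + n - j = n + n then B else 0)) = 0 := by
  refine Finset.sum_eq_zero fun j _ => ?_
  split_ifs with h1 h2
  · exfalso; omega
  · rw [mul_zero, mul_zero]
  · rw [zero_mul, mul_zero]
  · rw [mul_zero, mul_zero]

end Summit.Ventures.HSemireg.Mod4
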